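import Mathlib
import HarnessLib
import Summits.HubbardSuperconductivity.HubbardSuperconductivity.Theorems.KLProgrammeKLRegimeFlowReadPrivLast

/-!
# K3 gen-8-FLOW (stmt-HubbardSuperconductivity-20437 `KLRegimeEngineV17F2`, stub (C) `stub_twoLeg_curvature`): «(P)-DRIVER, DEDICATED FIRST STEP» —
# the private two-conjunct induction with the scale-`0` pair and the FIRST step keyed on a dedicated table (cell gate-hubbard-kl, seat p2 g28; cure (i) of located #19)

WHY.  k3c3-p1's `twoLegRead_registered_all_uniform` (…FlowReadPrivLast §6) runs the induction at ONE scale-uniform private table `(cc, cc′, x₀)` from the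
scale-`0` pair `h0` at that same table; the (C) closer therefore feeds the first step's (C1) door with the uniform table — infeasible with the `d = 128`
record (`firstStep_slopeKeyed_table128r_contra`).  THIS FILE is the driver's twin for the cure: the scale-`0` pair is given at a DEDICATED table
`(c0, c0′, x0)` below the private one (`c0 ≤ cc`, `c0′ ≤ cc′`, `x0 ≤ x₀` — e.g. `cD, cD′, 2⁵³` of ✓ …ScaleZeroRecordPairDedicated), the FIRST step
`0 → 1` is a separate hypothesis reading the dedicated pair (to be discharged by `twoLegReadPriv_flow_succ_table_u0f_inTables` at `m = 0`, `ci := c0`),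
and the uniform step is asked only from `m = 1`:
**`twoLegRead_registered_all_uniform_dedicatedFirst`** — `∀ n ≤ N + 1`, the REGISTERED pair at `(K_n, n)`.
Pure logic over landed definitions (`TwoLegReadJetBound.mono`, `TwoLegReadOscAt.mono`, the uniform driver); no definition; nothing here asserts (C), any stub of
20437, K3, the margin or superconductivity.  0 kit · 0 lit.
References: BGM 2006 §2.4 Lemma 2.1 (2.36)–(2.42) [cite: BenfattoGiulianiMastropietro2006].
-/

noncomputable section

namespace Summit.HubbardSuperconductivity.HubbardSuperconductivity.Theorems.KLRegimeSplit

set_option linter.dupNamespace false -- summit = problem name (single-conjunct summit), D-0017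

open Real
open Summit.HubbardSuperconductivity.HubbardSuperconductivity.Theorems.EngineV8

variable {L M : ℕ} [NeZero L] [NeZero M]

/-- **«(P)-DRIVER, DEDICATED FIRST STEP»**: ceilings `cc ≤ klC4aJetC2`, `cc′ ≤ klC4aJetC′ P R`, `x₀ ≤ klReadOscC P R`; a scale-`0` pair at a dedicated table
`(c0, c0′, x0)` dominated by the private one; the first step `(K₀, 0) → (K₁, 1)` FROM THE DEDICATED PAIR to the private table; the uniform private step for
`1 ≤ m`, `m + 1 ≤ N + 1` ⟹ the registered pair at every `n ≤ N + 1`. [cite: BenfattoGiulianiMastropietro2006, §2.4 Lemma 2.1 (2.36)–(2.42)] -/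
theorem twoLegRead_registered_all_uniform_dedicatedFirst {P : SplitConsts} {R : RenConsts} {β U μ : ℝ} {cc cc' c0 c0' : ℕ → ℝ} {x₀ x0 : ℝ} {N : ℕ}
    (hcc : ∀ k, cc k ≤ klC4aJetC2 k) (hcc' : ∀ k, cc' k ≤ klC4aJetC' P R k) (hx₀ : x₀ ≤ klReadOscC P R)
    (hd : ∀ k, c0 k ≤ cc k) (hd' : ∀ k, c0' k ≤ cc' k) (hdx : x0 ≤ x₀)
    (h0d : TwoLegReadJetBound L M c0 c0' β U μ (klFlowFrameU L M β U μ 0) 0 ∧ TwoLegReadOscAt L M x0 β U μ (klFlowFrameU L M β U μ 0) 0)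
    (hstep0 : (TwoLegReadJetBound L M c0 c0' β U μ (klFlowFrameU L M β U μ 0) 0 ∧ TwoLegReadOscAt L M x0 β U μ (klFlowFrameU L M β U μ 0) 0) →
      (TwoLegReadJetBound L M cc cc' β U μ (klFlowFrameU L M β U μ (0 + 1)) (0 + 1) ∧
        TwoLegReadOscAt L M x₀ β U μ (klFlowFrameU L M β U μ (0 + 1)) (0 + 1)))
    (hstep : ∀ m, 1 ≤ m → m + 1 ≤ N + 1 →
      (TwoLegReadJetBound L M cc cc' β U μ (klFlowFrameU L M β U μ m) m ∧ TwoLegReadOscAt L M x₀ β U μ (klFlowFrameU L M β U μ m) m) →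
      (TwoLegReadJetBound L M cc cc' β U μ (klFlowFrameU L M β U μ (m + 1)) (m + 1) ∧
        TwoLegReadOscAt L M x₀ β U μ (klFlowFrameU L M β U μ (m + 1)) (m + 1))) :
    ∀ n ≤ N + 1, TwoLegReadJetBound L M klC4aJetC2 (klC4aJetC' P R) β U μ (klFlowFrameU L M β U μ n) n ∧
      TwoLegReadOscAt L M (klReadOscC P R) β U μ (klFlowFrameU L M β U μ n) n := by
  -- the private pair at scale 0 by domination, then the uniform driver with the first step swapped
  have h0 : TwoLegReadJetBound L M cc cc' β U μ (klFlowFrameU L M β U μ 0) 0 ∧ TwoLegReadOscAt L M x₀ β U μ (klFlowFrameU L M β U μ 0) 0 :=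
    ⟨h0d.1.mono hd hd', h0d.2.mono hdx⟩
  refine twoLegRead_registered_all_uniform (P := P) (R := R) hcc hcc' hx₀ h0 fun m hm hpair => ?_
  rcases Nat.eq_zero_or_pos m with rfl | hm1
  · exact hstep0 h0d
  · exact hstep m hm1 hm hpair

/-- The same with the FIRST-STEP OUTPUT written at scale `1` (no `0 + 1`), for callers whose step lemma concludes at `(K₁, 1)` literally.
[cite: BenfattoGiulianiMastropietro2006, §2.4 Lemma 2.1 (2.36)–(2.42)] -/
theorem twoLegRead_registered_all_uniform_dedicatedFirst' {P : SplitConsts} {R : RenConsts} {β U μ : ℝ} {cc cc' c0 c0' : ℕ → ℝ} {x₀ x0 : ℝ} {N : ℕ}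
    (hcc : ∀ k, cc k ≤ klC4aJetC2 k) (hcc' : ∀ k, cc' k ≤ klC4aJetC' P R k) (hx₀ : x₀ ≤ klReadOscC P R)
    (hd : ∀ k, c0 k ≤ cc k) (hd' : ∀ k, c0' k ≤ cc' k) (hdx : x0 ≤ x₀)
    (h0d : TwoLegReadJetBound L M c0 c0' β U μ (klFlowFrameU L M β U μ 0) 0 ∧ TwoLegReadOscAt L M x0 β U μ (klFlowFrameU L M β U μ 0) 0)
    (hstep0 : (TwoLegReadJetBound L M c0 c0' β U μ (klFlowFrameU L M β U μ 0) 0 ∧ TwoLegReadOscAt L M x0 β U μ (klFlowFrameU L M β U μ 0) 0) →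
      (TwoLegReadJetBound L M cc cc' β U μ (klFlowFrameU L M β U μ 1) 1 ∧ TwoLegReadOscAt L M x₀ β U μ (klFlowFrameU L M β U μ 1) 1))
    (hstep : ∀ m, 1 ≤ m → m + 1 ≤ N + 1 →
      (TwoLegReadJetBound L M cc cc' β U μ (klFlowFrameU L M β U μ m) m ∧ TwoLegReadOscAt L M x₀ β U μ (klFlowFrameU L M β U μ m) m) →
      (TwoLegReadJetBound L M cc cc' β U μ (klFlowFrameU L M β U μ (m + 1)) (m + 1) ∧
        TwoLegReadOscAt L M x₀ β U μ (klFlowFrameU L M β U μ (m + 1)) (m + 1))) :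
    ∀ n ≤ N + 1, TwoLegReadJetBound L M klC4aJetC2 (klC4aJetC' P R) β U μ (klFlowFrameU L M β U μ n) n ∧
      TwoLegReadOscAt L M (klReadOscC P R) β U μ (klFlowFrameU L M β U μ n) n :=
  twoLegRead_registered_all_uniform_dedicatedFirst (L := L) (M := M) hcc hcc' hx₀ hd hd' hdx h0d (fun h => by simpa using hstep0 h) hstep

/-- **«(P)-DRIVER, DEDICATED FIRST STEP», non-uniform form** (for the LAST-index one-calls `…_all_table_u0f_h0hist` / `…_all_deep_u0f_h0hist`, which run
`twoLegRead_registered_all` with a separate registered last step `hlast`): the scale-`0` pair at a dedicated dominated table, the first step from it, the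
uniform private step for `1 ≤ m`, `m + 1 ≤ N`, and the last step `N → N + 1` to the registered tables. [cite: BenfattoGiulianiMastropietro2006, §2.4 Lemma 2.1 (2.36)–(2.42)] -/
theorem twoLegRead_registered_all_dedicatedFirst {P : SplitConsts} {R : RenConsts} {β U μ : ℝ} {cc cc' c0 c0' : ℕ → ℝ} {x₀ x0 : ℝ} {N : ℕ}
    (hcc : ∀ k, cc k ≤ klC4aJetC2 k) (hcc' : ∀ k, cc' k ≤ klC4aJetC' P R k) (hx₀ : x₀ ≤ klReadOscC P R)
    (hd : ∀ k, c0 k ≤ cc k) (hd' : ∀ k, c0' k ≤ cc' k) (hdx : x0 ≤ x₀)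
    (h0d : TwoLegReadJetBound L M c0 c0' β U μ (klFlowFrameU L M β U μ 0) 0 ∧ TwoLegReadOscAt L M x0 β U μ (klFlowFrameU L M β U μ 0) 0)
    (hstep0 : 1 ≤ N → (TwoLegReadJetBound L M c0 c0' β U μ (klFlowFrameU L M β U μ 0) 0 ∧ TwoLegReadOscAt L M x0 β U μ (klFlowFrameU L M β U μ 0) 0) →
      (TwoLegReadJetBound L M cc cc' β U μ (klFlowFrameU L M β U μ 1) 1 ∧ TwoLegReadOscAt L M x₀ β U μ (klFlowFrameU L M β U μ 1) 1))
    (hstep : ∀ m, 1 ≤ m → m + 1 ≤ N →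
      (TwoLegReadJetBound L M cc cc' β U μ (klFlowFrameU L M β U μ m) m ∧ TwoLegReadOscAt L M x₀ β U μ (klFlowFrameU L M β U μ m) m) →
      (TwoLegReadJetBound L M cc cc' β U μ (klFlowFrameU L M β U μ (m + 1)) (m + 1) ∧
        TwoLegReadOscAt L M x₀ β U μ (klFlowFrameU L M β U μ (m + 1)) (m + 1)))
    (hlast0 : N = 0 → (TwoLegReadJetBound L M c0 c0' β U μ (klFlowFrameU L M β U μ 0) 0 ∧ TwoLegReadOscAt L M x0 β U μ (klFlowFrameU L M β U μ 0) 0) →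
      (TwoLegReadJetBound L M klC4aJetC2 (klC4aJetC' P R) β U μ (klFlowFrameU L M β U μ (N + 1)) (N + 1) ∧
        TwoLegReadOscAt L M (klReadOscC P R) β U μ (klFlowFrameU L M β U μ (N + 1)) (N + 1)))
    (hlast : 1 ≤ N → (TwoLegReadJetBound L M cc cc' β U μ (klFlowFrameU L M β U μ N) N ∧ TwoLegReadOscAt L M x₀ β U μ (klFlowFrameU L M β U μ N) N) →
      (TwoLegReadJetBound L M klC4aJetC2 (klC4aJetC' P R) β U μ (klFlowFrameU L M β U μ (N + 1)) (N + 1) ∧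
        TwoLegReadOscAt L M (klReadOscC P R) β U μ (klFlowFrameU L M β U μ (N + 1)) (N + 1))) :
    ∀ n ≤ N + 1, TwoLegReadJetBound L M klC4aJetC2 (klC4aJetC' P R) β U μ (klFlowFrameU L M β U μ n) n ∧
      TwoLegReadOscAt L M (klReadOscC P R) β U μ (klFlowFrameU L M β U μ n) n := by
  -- private pair at every `1 ≤ n ≤ N` from the dedicated first step and the uniform steps
  have hpriv : ∀ n, 1 ≤ n → n ≤ N → TwoLegReadJetBound L M cc cc' β U μ (klFlowFrameU L M β U μ n) n ∧
      TwoLegReadOscAt L M x₀ β U μ (klFlowFrameU L M β U μ n) n := by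
    intro n hn1 hnN
    induction n with
    | zero => exact absurd hn1 (by omega)
    | succ m ih =>
      rcases Nat.eq_zero_or_pos m with rfl | hm1
      · exact hstep0 (by omega) h0d
      · exact hstep m hm1 (by omega) (ih hm1 (by omega))
  intro n hn
  rcases Nat.eq_zero_or_pos n with rfl | hn1
  · exact ⟨(h0d.1.mono hd hd').mono hcc hcc', (h0d.2.mono hdx).mono hx₀⟩
  rcases Nat.lt_or_ge n (N + 1) with hlt | hge
  · exact twoLegRead_registered_of_priv hcc hcc' hx₀ (hpriv n hn1 (by omega))
  · obtain rfl : n = N + 1 := le_antisymm hn hge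
    rcases Nat.eq_zero_or_pos N with hN0 | hN1
    · exact hlast0 hN0 h0d
    · exact hlast hN1 (hpriv N hN1 le_rfl)

end Summit.HubbardSuperconductivity.HubbardSuperconductivity.Theorems.KLRegimeSplit

end
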